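import Literature.MathematicalPhysics.QuantumLattice.EmeryThreeBandRing8ClusterDictionary
import Summits.Ventures.CertifiedManyBodySolver.Downfold.EmeryClusterFloorSeam
import Summits.Ventures.CertifiedManyBodySolver.Downfold.EmeryCuprateSigns
import Summits.Ventures.CertifiedManyBodySolver.Downfold.EmeryReferenceLevel
import HarnessLib

/-!
# Emery RING-8 (`Cu₄O₄`, 4900-class) cluster floors for Sr₀.₉La₀.₁CuO₂ (M37; row 55): CLAIM NODES (replay-layer exact-integer certificates, kit j310438) and the
# CONDITIONAL corner floors — corner floors (E/CuO₂) 13.0300 / 12.8925 / 12.9400 / 12.8025 at ρ = 51/40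

Venture CertifiedManyBodySolver; cell `pub/hubbard-fast`, S2 CERTIFIER-FAMILIES (iv) multi-band; seat hubbard-box-p3 g19. Sister file of
`EmeryRing8_La214x_Hg1201x_splitNodes_j310192` (read its header for the method); namespace `Summit.Ventures.CertifiedManyBodySolver.Certificates`.

CLAIM per corner `θᵢ` of `ring8SLCOCorner` (order (t_pd, t_pp, ε_d, ε_p, U_d, U_p) = mod-4's PLUS-TABLES-batch2 row 55; sign pattern `cuprateSigns`) and the fixed
tilt `μᵢ`: `q₀ᵢ ≤ E₀(hubbardOpenBoxGP 1 8 (ring8Tau θᵢ' 4) (ring8Ups θᵢ' 4) (ring8Nu θᵢ' 4), k)` for every `k ≤ 16`, `θᵢ' = emeryLine cuprateSigns (ring8SLCOCorner i) + μᵢ • levelDir`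
— CERTIFIED by kit j310438 in exact integer arithmetic on all 81 spin sectors of `100·h^G − 100q₀·1` (engine D exact residual dominance on every sector,
engine S dominant split p628148 on the big ones; conventions gate j310188). Recorded as `@[conjecture]` nodes, dischargeable in the kernel by a split-reading coded-cluster
checker (`theorem cert_…_holds`, no change downstream). KERNEL CONTENT (0 sorry): the conditional corner floor families `q₀ᵢ/16 − μᵢρ ≤ e(emeryLine cuprateSigns cornerᵢ, ρ)`,
`ρ ∈ [0, 3/2]` (box-p1 `le_emeryEnergyDensity_of_ring8_gpSectorFloors` + mod-4 `emeryEnergyDensity_add_levelShift`) — the typed box words are mod-4's to close (their word file for this row is in flight; the corner literals below ARE the row's lower-face corners).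

HONEST FRAMING: node-conditional (replay layer) until kernel discharge; Anderson-type cluster floors on SCREENING-GRADE box objects; ENERGY words only — no phase sentence;
the hypothesis-free plus words stay the unconditional floor of record.

* Valentí, Stolze, Hirschfeld, PRB 43 (1991) 13743, §II. [cite: ValentiStolzeHirschfeld1991, §II]
* S. M. Rump, BIT 46 (2006) 433, §2. [cite: Rump2006PosDef, §2]
* P. W. Anderson, Phys. Rev. 83 (1951) 1260, eq. (2). [cite: Anderson1951, eq. (2)]
* R. B. Israel, Convexity in the theory of lattice gases (1979), Thm. I.3.4. [cite: Israel1979, Thm. I.3.4]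
-/

noncomputable section

namespace Summit.Ventures.CertifiedManyBodySolver.Certificates

open Literature.MathematicalPhysics.QuantumLattice Literature.Probability.LatticeModels
open HubbardWave0 ThermodynamicLimit ClusterLowerBound
open Summit.Ventures.CertifiedManyBodySolver.Downfold
open scoped BigOperators ComplexOrder

/-- **The lower-face corner sheet of row 55** (order (t_pd, t_pp, ε_d, ε_p, U_d, U_p), eV, εp = 0; mod-4 PLUS-TABLES-batch2). [folklore] -/
def ring8SLCOCorner : Fin 4 → Fin 6 → ℝ := ![![129/100, 37/50, 21/10, 0, 222/25, 144/25], ![34/25, 37/50, 21/10, 0, 222/25, 144/25], ![129/100, 41/50, 21/10, 0, 222/25, 144/25], ![34/25, 41/50, 21/10, 0, 222/25, 144/25]]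

/-- The four tilts `μ` (eV; float-scan optima of kit j310438, fixed on the 1/20 grid). [folklore] -/
def ring8SLCO_mu : Fin 4 → ℝ := ![-(23/2), -(231/20), -(23/2), -(231/20)]

/-- The four certified ring-8 cluster levels `q₀` (cluster units, mass `M = 4`; = `q0_int/100` of kit j310438). [folklore] -/
def ring8SLCO_q0 : Fin 4 → ℝ := ![-(4562/25), -(3681/20), -(4571/25), -(18441/100)]

/-- **CLAIM NODE — ring-8 cluster floor at corner 0 of `ring8SLCOCorner`** (tilt `μ = -23/2`): for every `k ≤ 16`,
`-4562/25 ≤ E₀(hubbardOpenBoxGP 1 8 (ring8Tau θ' 4) (ring8Ups θ' 4) (ring8Nu θ' 4), k)`, `θ' = emeryLine cuprateSigns (ring8SLCOCorner 0) + μ • levelDir`.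
A finite-dimensional numerical fact (81 spin sectors, dimension ≤ 4900), certified in exact integer arithmetic by kit j310438 (81/81 sectors PASS,
float `λ_min = -182.398903`) — NOT a theorem of this file. [computation: ring8cert/j310438 engine-D exact-residual + engine-S dominant-split] [cite: Rump2006PosDef, §2] -/
@[conjecture] def cert_emeryRing8_SLCOx_c0_j310438 : Prop :=
  ∀ k ≤ 16, (-(4562/25) : ℝ) ≤ groundEnergy (hubbardOpenBoxGP 1 8 (ring8Tau (emeryLine cuprateSigns (ring8SLCOCorner 0) + (-(23/2) : ℝ) • levelDir) 4) (ring8Ups (emeryLine cuprateSigns (ring8SLCOCorner 0) + (-(23/2) : ℝ) • levelDir) 4) (ring8Nu (emeryLine cuprateSigns (ring8SLCOCorner 0) + (-(23/2) : ℝ) • levelDir) 4)) k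

/-- **CLAIM NODE — ring-8 cluster floor at corner 1 of `ring8SLCOCorner`** (tilt `μ = -231/20`): for every `k ≤ 16`,
`-3681/20 ≤ E₀(hubbardOpenBoxGP 1 8 (ring8Tau θ' 4) (ring8Ups θ' 4) (ring8Nu θ' 4), k)`, `θ' = emeryLine cuprateSigns (ring8SLCOCorner 1) + μ • levelDir`.
A finite-dimensional numerical fact (81 spin sectors, dimension ≤ 4900), certified in exact integer arithmetic by kit j310438 (81/81 sectors PASS,
float `λ_min = -183.967133`) — NOT a theorem of this file. [computation: ring8cert/j310438 engine-D exact-residual + engine-S dominant-split] [cite: Rump2006PosDef, §2] -/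
@[conjecture] def cert_emeryRing8_SLCOx_c1_j310438 : Prop :=
  ∀ k ≤ 16, (-(3681/20) : ℝ) ≤ groundEnergy (hubbardOpenBoxGP 1 8 (ring8Tau (emeryLine cuprateSigns (ring8SLCOCorner 1) + (-(231/20) : ℝ) • levelDir) 4) (ring8Ups (emeryLine cuprateSigns (ring8SLCOCorner 1) + (-(231/20) : ℝ) • levelDir) 4) (ring8Nu (emeryLine cuprateSigns (ring8SLCOCorner 1) + (-(231/20) : ℝ) • levelDir) 4)) k

/-- **CLAIM NODE — ring-8 cluster floor at corner 2 of `ring8SLCOCorner`** (tilt `μ = -23/2`): for every `k ≤ 16`,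
`-4571/25 ≤ E₀(hubbardOpenBoxGP 1 8 (ring8Tau θ' 4) (ring8Ups θ' 4) (ring8Nu θ' 4), k)`, `θ' = emeryLine cuprateSigns (ring8SLCOCorner 2) + μ • levelDir`.
A finite-dimensional numerical fact (81 spin sectors, dimension ≤ 4900), certified in exact integer arithmetic by kit j310438 (81/81 sectors PASS,
float `λ_min = -182.752234`) — NOT a theorem of this file. [computation: ring8cert/j310438 engine-D exact-residual + engine-S dominant-split] [cite: Rump2006PosDef, §2] -/
@[conjecture] def cert_emeryRing8_SLCOx_c2_j310438 : Prop :=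
  ∀ k ≤ 16, (-(4571/25) : ℝ) ≤ groundEnergy (hubbardOpenBoxGP 1 8 (ring8Tau (emeryLine cuprateSigns (ring8SLCOCorner 2) + (-(23/2) : ℝ) • levelDir) 4) (ring8Ups (emeryLine cuprateSigns (ring8SLCOCorner 2) + (-(23/2) : ℝ) • levelDir) 4) (ring8Nu (emeryLine cuprateSigns (ring8SLCOCorner 2) + (-(23/2) : ℝ) • levelDir) 4)) k

/-- **CLAIM NODE — ring-8 cluster floor at corner 3 of `ring8SLCOCorner`** (tilt `μ = -231/20`): for every `k ≤ 16`,
`-18441/100 ≤ E₀(hubbardOpenBoxGP 1 8 (ring8Tau θ' 4) (ring8Ups θ' 4) (ring8Nu θ' 4), k)`, `θ' = emeryLine cuprateSigns (ring8SLCOCorner 3) + μ • levelDir`.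
A finite-dimensional numerical fact (81 spin sectors, dimension ≤ 4900), certified in exact integer arithmetic by kit j310438 (81/81 sectors PASS,
float `λ_min = -184.328957`) — NOT a theorem of this file. [computation: ring8cert/j310438 engine-D exact-residual + engine-S dominant-split] [cite: Rump2006PosDef, §2] -/
@[conjecture] def cert_emeryRing8_SLCOx_c3_j310438 : Prop :=
  ∀ k ≤ 16, (-(18441/100) : ℝ) ≤ groundEnergy (hubbardOpenBoxGP 1 8 (ring8Tau (emeryLine cuprateSigns (ring8SLCOCorner 3) + (-(231/20) : ℝ) • levelDir) 4) (ring8Ups (emeryLine cuprateSigns (ring8SLCOCorner 3) + (-(231/20) : ℝ) • levelDir) 4) (ring8Nu (emeryLine cuprateSigns (ring8SLCOCorner 3) + (-(231/20) : ℝ) • levelDir) 4)) k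

/-- **Conditional corner floor 0**: `q₀/16 − μ·ρ ≤ e(emeryLine cuprateSigns (ring8SLCOCorner 0), ρ)` for every `ρ ∈ [0, 3/2]`.
[cite: ValentiStolzeHirschfeld1991, §II] [cite: Anderson1951, eq. (2)] -/
theorem ring8SLCO_cornerFloor0 (h : cert_emeryRing8_SLCOx_c0_j310438) {ρ : ℝ} (hρ0 : 0 ≤ ρ) (hρ1 : ρ ≤ 3 / 2) :
    (-(4562/25) : ℝ) / (4 * 4) - (-(23/2) : ℝ) * ρ ≤ emeryEnergyDensity (emeryLine cuprateSigns (ring8SLCOCorner 0)) ρ := by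
  have hS := InfVolFermionState.emeryStates_nonempty hρ0 hρ1
  have h1 := le_emeryEnergyDensity_of_ring8_gpSectorFloors (emeryLine cuprateSigns (ring8SLCOCorner 0) + (-(23/2) : ℝ) • levelDir) 4 hρ0 hρ1 (by norm_num) h
  rw [emeryEnergyDensity_add_levelShift hS] at h1
  linarith

/-- **Conditional corner floor 1**: `q₀/16 − μ·ρ ≤ e(emeryLine cuprateSigns (ring8SLCOCorner 1), ρ)` for every `ρ ∈ [0, 3/2]`.
[cite: ValentiStolzeHirschfeld1991, §II] [cite: Anderson1951, eq. (2)] -/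
theorem ring8SLCO_cornerFloor1 (h : cert_emeryRing8_SLCOx_c1_j310438) {ρ : ℝ} (hρ0 : 0 ≤ ρ) (hρ1 : ρ ≤ 3 / 2) :
    (-(3681/20) : ℝ) / (4 * 4) - (-(231/20) : ℝ) * ρ ≤ emeryEnergyDensity (emeryLine cuprateSigns (ring8SLCOCorner 1)) ρ := by
  have hS := InfVolFermionState.emeryStates_nonempty hρ0 hρ1
  have h1 := le_emeryEnergyDensity_of_ring8_gpSectorFloors (emeryLine cuprateSigns (ring8SLCOCorner 1) + (-(231/20) : ℝ) • levelDir) 4 hρ0 hρ1 (by norm_num) h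
  rw [emeryEnergyDensity_add_levelShift hS] at h1
  linarith

/-- **Conditional corner floor 2**: `q₀/16 − μ·ρ ≤ e(emeryLine cuprateSigns (ring8SLCOCorner 2), ρ)` for every `ρ ∈ [0, 3/2]`.
[cite: ValentiStolzeHirschfeld1991, §II] [cite: Anderson1951, eq. (2)] -/
theorem ring8SLCO_cornerFloor2 (h : cert_emeryRing8_SLCOx_c2_j310438) {ρ : ℝ} (hρ0 : 0 ≤ ρ) (hρ1 : ρ ≤ 3 / 2) :
    (-(4571/25) : ℝ) / (4 * 4) - (-(23/2) : ℝ) * ρ ≤ emeryEnergyDensity (emeryLine cuprateSigns (ring8SLCOCorner 2)) ρ := by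
  have hS := InfVolFermionState.emeryStates_nonempty hρ0 hρ1
  have h1 := le_emeryEnergyDensity_of_ring8_gpSectorFloors (emeryLine cuprateSigns (ring8SLCOCorner 2) + (-(23/2) : ℝ) • levelDir) 4 hρ0 hρ1 (by norm_num) h
  rw [emeryEnergyDensity_add_levelShift hS] at h1
  linarith

/-- **Conditional corner floor 3**: `q₀/16 − μ·ρ ≤ e(emeryLine cuprateSigns (ring8SLCOCorner 3), ρ)` for every `ρ ∈ [0, 3/2]`.
[cite: ValentiStolzeHirschfeld1991, §II] [cite: Anderson1951, eq. (2)] -/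
theorem ring8SLCO_cornerFloor3 (h : cert_emeryRing8_SLCOx_c3_j310438) {ρ : ℝ} (hρ0 : 0 ≤ ρ) (hρ1 : ρ ≤ 3 / 2) :
    (-(18441/100) : ℝ) / (4 * 4) - (-(231/20) : ℝ) * ρ ≤ emeryEnergyDensity (emeryLine cuprateSigns (ring8SLCOCorner 3)) ρ := by
  have hS := InfVolFermionState.emeryStates_nonempty hρ0 hρ1
  have h1 := le_emeryEnergyDensity_of_ring8_gpSectorFloors (emeryLine cuprateSigns (ring8SLCOCorner 3) + (-(231/20) : ℝ) • levelDir) 4 hρ0 hρ1 (by norm_num) h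
  rw [emeryEnergyDensity_add_levelShift hS] at h1
  linarith

/-- **All four conditional corner floors** in the seam's `hm` shape. [cite: Anderson1951, eq. (2)] -/
theorem ring8SLCO_cornerFloor (h0 : cert_emeryRing8_SLCOx_c0_j310438) (h1 : cert_emeryRing8_SLCOx_c1_j310438) (h2 : cert_emeryRing8_SLCOx_c2_j310438) (h3 : cert_emeryRing8_SLCOx_c3_j310438) {ρ : ℝ} (hρ0 : 0 ≤ ρ) (hρ1 : ρ ≤ 3 / 2) :
    ∀ i : Fin 4, ring8SLCO_q0 i / (4 * 4) - ring8SLCO_mu i * ρ ≤ emeryEnergyDensity (emeryLine cuprateSigns (ring8SLCOCorner i)) ρ := by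
  intro i
  fin_cases i
  · simpa [ring8SLCO_q0, ring8SLCO_mu] using ring8SLCO_cornerFloor0 h0 hρ0 hρ1
  · simpa [ring8SLCO_q0, ring8SLCO_mu] using ring8SLCO_cornerFloor1 h1 hρ0 hρ1
  · simpa [ring8SLCO_q0, ring8SLCO_mu] using ring8SLCO_cornerFloor2 h2 hρ0 hρ1
  · simpa [ring8SLCO_q0, ring8SLCO_mu] using ring8SLCO_cornerFloor3 h3 hρ0 hρ1

/-- Affine domination on an interval from the two ends (both bounds consumed). [folklore] -/
private theorem ring8SLCO_affine_dom {α β lo hi ρ : ℝ} (hlo : 0 ≤ α + β * lo) (hhi : 0 ≤ α + β * hi) (h1 : lo ≤ ρ) (h2 : ρ ≤ hi) (hlh : lo < hi) :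
    0 ≤ α + β * ρ := by
  nlinarith [mul_nonneg (sub_nonneg.2 h1) hhi, mul_nonneg (sub_nonneg.2 h2) hlo]

/-- **The ring-8 filling line of this row** = binding corner 3's tilted line `q₀/16 − μ·ρ = 231/20·ρ − 18441/1600` (eV per lattice site); it is the lower
envelope of the four corner lines exactly on `ρ ∈ [0, 3/2]`; at ρ = 51/40 it is `3.2006250`, at ρ = 51/40 `3.2006250`. [folklore] -/
def ring8SLCOFloorLine (ρ : ℝ) : ℝ := (231/20 : ℝ) * ρ - (18441/1600 : ℝ)

/-- The line lies below corner 0's floor line on `ρ ∈ [0, 3/2]` (difference `193/1600 + (-1/20)·ρ`). [folklore] -/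
theorem ring8SLCOFloorLine_le_corner0 {ρ : ℝ} (hρ : ρ ∈ Set.Icc (0 : ℝ) (3/2)) :
    ring8SLCOFloorLine ρ ≤ ring8SLCO_q0 0 / (4 * 4) - ring8SLCO_mu 0 * ρ := by
  have h := ring8SLCO_affine_dom (α := (193/1600 : ℝ)) (β := (-(1/20) : ℝ)) (lo := 0) (hi := 3/2) (ρ := ρ)
    (by norm_num) (by norm_num) hρ.1 hρ.2 (by norm_num)
  simp only [ring8SLCOFloorLine, ring8SLCO_q0, ring8SLCO_mu, Matrix.cons_val]
  linarith

/-- The line lies below corner 1's floor line on `ρ ∈ [0, 3/2]` (difference `9/400 + (0)·ρ`). [folklore] -/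
theorem ring8SLCOFloorLine_le_corner1 {ρ : ℝ} (hρ : ρ ∈ Set.Icc (0 : ℝ) (3/2)) :
    ring8SLCOFloorLine ρ ≤ ring8SLCO_q0 1 / (4 * 4) - ring8SLCO_mu 1 * ρ := by
  have h := ring8SLCO_affine_dom (α := (9/400 : ℝ)) (β := (0 : ℝ)) (lo := 0) (hi := 3/2) (ρ := ρ)
    (by norm_num) (by norm_num) hρ.1 hρ.2 (by norm_num)
  simp only [ring8SLCOFloorLine, ring8SLCO_q0, ring8SLCO_mu, Matrix.cons_val]
  linarith

/-- The line lies below corner 2's floor line on `ρ ∈ [0, 3/2]` (difference `157/1600 + (-1/20)·ρ`). [folklore] -/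
theorem ring8SLCOFloorLine_le_corner2 {ρ : ℝ} (hρ : ρ ∈ Set.Icc (0 : ℝ) (3/2)) :
    ring8SLCOFloorLine ρ ≤ ring8SLCO_q0 2 / (4 * 4) - ring8SLCO_mu 2 * ρ := by
  have h := ring8SLCO_affine_dom (α := (157/1600 : ℝ)) (β := (-(1/20) : ℝ)) (lo := 0) (hi := 3/2) (ρ := ρ)
    (by norm_num) (by norm_num) hρ.1 hρ.2 (by norm_num)
  simp only [ring8SLCOFloorLine, ring8SLCO_q0, ring8SLCO_mu, Matrix.cons_val]
  linarith

/-- The line lies below corner 3's floor line on `ρ ∈ [0, 3/2]` (difference `0 + (0)·ρ`). [folklore] -/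
theorem ring8SLCOFloorLine_le_corner3 {ρ : ℝ} (hρ : ρ ∈ Set.Icc (0 : ℝ) (3/2)) :
    ring8SLCOFloorLine ρ ≤ ring8SLCO_q0 3 / (4 * 4) - ring8SLCO_mu 3 * ρ := by
  have h := ring8SLCO_affine_dom (α := (0 : ℝ)) (β := (0 : ℝ)) (lo := 0) (hi := 3/2) (ρ := ρ)
    (by norm_num) (by norm_num) hρ.1 hρ.2 (by norm_num)
  simp only [ring8SLCOFloorLine, ring8SLCO_q0, ring8SLCO_mu, Matrix.cons_val]
  linarith

/-- The line is below all four corner floor lines on `ρ ∈ [0, 3/2]`. [folklore] -/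
theorem ring8SLCOFloorLine_le_corner (i : Fin 4) {ρ : ℝ} (hρ : ρ ∈ Set.Icc (0 : ℝ) (3/2)) :
    ring8SLCOFloorLine ρ ≤ ring8SLCO_q0 i / (4 * 4) - ring8SLCO_mu i * ρ := by
  fin_cases i
  · exact ring8SLCOFloorLine_le_corner0 hρ
  · exact ring8SLCOFloorLine_le_corner1 hρ
  · exact ring8SLCOFloorLine_le_corner2 hρ
  · exact ring8SLCOFloorLine_le_corner3 hρ

/-- **Conditional line floor at every corner**: for `ρ ∈ [0, 3/2]`, `ring8SLCOFloorLine ρ ≤ e(emeryLine cuprateSigns (ring8SLCOCorner i), ρ)` for all four corners —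
the `hm` of mod-4's seam at any fixed filling in the range. [cite: Anderson1951, eq. (2)] -/
theorem ring8SLCO_lineFloor (h0 : cert_emeryRing8_SLCOx_c0_j310438) (h1 : cert_emeryRing8_SLCOx_c1_j310438) (h2 : cert_emeryRing8_SLCOx_c2_j310438) (h3 : cert_emeryRing8_SLCOx_c3_j310438) {ρ : ℝ} (hρ : ρ ∈ Set.Icc (0 : ℝ) (3/2)) :
    ∀ i : Fin 4, ring8SLCOFloorLine ρ ≤ emeryEnergyDensity (emeryLine cuprateSigns (ring8SLCOCorner i)) ρ :=
  fun i => (ring8SLCOFloorLine_le_corner i hρ).trans (ring8SLCO_cornerFloor h0 h1 h2 h3 (le_trans (by norm_num) hρ.1) (le_trans hρ.2 (by norm_num)) i)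

end Summit.Ventures.CertifiedManyBodySolver.Certificates

end
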